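import Mathlib
import HarnessLib
import Summits.NavierStokesRegularity.NavierStokesRegularity.Theorems.PeepholeEchoDoorCore

/-!
# PeepholeEchoDoorResidues — S23 «PeepholeEchoDoor» (two-time peephole doors), part 3/4

§3 K1 PROVED (`localPointZoomTwoTime_holds`, decay variant `localPointZoomTwoTime_decay`) and §4 the residue algebra on the (κ, μ)-plane: off-diagonal pairs die by the Type-I rate (`eq_zero_of_twoPoint_lt`, `offDiagonalResidue_holds`), all ratios ⇒ self-similar ⇒ Tsai-in-class (`allRatiosResidue_holds`), two incommensurable ratios ⇒ all ratios (Kronecker, `hasTwoPointSymmetry_all_of_two`).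

Door family of LADDER-NS N0 (local Type-I window doors S20/S21-C/S22/S23); THEOREMS-ONLY landing of the nsreg-p1 design
`run/shared/lean/pub/ns-regularity-ideate/ns-regularity-ideate-p1/r22/Sketch23.lean` (ROUND-22.md). Conditional door
theorems: they EVADE hard core 10661 by hypothesis (T1/T2/T3/T5) or MEET it at the named wall (T4-D); no route, no items
(DIRECTOR-NS standing #32 (2)). WHAT THIS IS NOT: not a regularity claim; not an attack on `TypeIDSSLiouville`.
-/

noncomputable section

set_option linter.dupNamespace false

namespace Summit.NavierStokesRegularity.NavierStokesRegularity.Theorems.PeepholeEchoDoorResidues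

open MeasureTheory Set Function Filter Topology TopologicalSpace Metric
open scoped RealInnerProductSpace NNReal ENNReal Topology Pointwise
open Literature.Analysis Literature.Analysis.FluidPDE
open Summit.NavierStokesRegularity.NavierStokesRegularity.Theorems.LocalSineTubeDoorProfileAlignedWindowRigidityAncient
open Summit.NavierStokesRegularity.NavierStokesRegularity.Theorems.PoloidalWindowDoorPoloidalWindowRigidityStrata
open Summit.NavierStokesRegularity.NavierStokesRegularity.Theorems.PoloidalWindowDoorPoloidalWindowRigidityFlat
open Summit.NavierStokesRegularity.NavierStokesRegularity.Theorems.PoloidalWindowDoorPoloidalWindowRigidityWindow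
open Summit.NavierStokesRegularity.NavierStokesRegularity.Theorems.PeepholeEchoDoorDefs
open Summit.NavierStokesRegularity.NavierStokesRegularity.Theorems.PeepholeEchoDoorCore

/-! ## §3 K1: the universal two-time zoom (time Type I, and the decay variant) -/

/-- **K1 PROVED**: the universal two-time zoom `LocalPointZoomTwoTime` (tree velocity zoom `localPointZoomVelSlices` +
Fatou through the peephole `twoTime_windowLimit` + analytic spread `hasTwoPointSymmetry_of_window`). -/
theorem localPointZoomTwoTime_holds : LocalPointZoomTwoTime := by
  intro ν T hν hT u p hcl hLH hdec x₀ ρ M hρ hM hnot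
  obtain ⟨C, v, lam, hlam, hlam0, ⟨hrate, hcont, hmild, hdiv⟩, hsing, hconv⟩ :=
    Summit.NavierStokesRegularity.NavierStokesRegularity.Theorems.LocalVelCompTubeDoorLocalPointZoomVelSlices.localPointZoomVelSlices
      ν T hν hT u p hcl hLH hdec x₀ ρ M hρ hM hnot
  refine ⟨C, v, hrate, hcont, hmild, hdiv, hsing, fun κ μ hκ hμ U hU hUne hfade => ?_⟩
  have hslice : ∀ s < 0, Continuous (v s) := fun s hs => by
    rw [← continuousOn_univ]
    exact (analyticOnNhd_slice hcont (bdd_of_hasTypeITimeDecay hrate) hmild hs).continuousOn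
  exact hasTwoPointSymmetry_of_window hrate hcont hmild hν hκ hμ hU hUne fun s hs y hy =>
    twoTime_windowLimit hν hT hcl hlam hlam0 hslice hconv hκ hμ hU hfade hs hy

/-- K1-D: the same with a SPACE–time local Type-I hypothesis, delivering in addition the decay
`‖v(s,z)‖ ≤ (M/ν)/(‖z‖ + √(−s))` (tree `localPointZoomVelSlices`, `hasTypeIDecay_of_zoom`). -/
theorem localPointZoomTwoTime_decay (ν T : ℝ) (hν : 0 < ν) (hT : 0 < T)
    (u : ℝ → EuclideanSpace ℝ (Fin 3) → EuclideanSpace ℝ (Fin 3)) (p : ℝ → EuclideanSpace ℝ (Fin 3) → ℝ)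
    (hcl : IsClassicalNSSolutionOn (Set.Ico 0 T) ν 0 u p) (hLH : IsLerayHopfOn T ν 0 (u 0) u)
    (hdec : HasRapidSpatialDecay (u 0)) (x₀ : EuclideanSpace ℝ (Fin 3)) (ρ M : ℝ) (hρ : 0 < ρ)
    (hM : ∀ t ∈ Set.Ico 0 T, T - ρ ^ 2 < t → ∀ x ∈ Metric.ball x₀ ρ, ‖u t x‖ * (‖x - x₀‖ + Real.sqrt (ν * (T - t))) ≤ M)
    (hnot : ¬ IsBackwardBoundedAt u T x₀) :
    ∃ (C : ℝ) (v : ℝ → EuclideanSpace ℝ (Fin 3) → EuclideanSpace ℝ (Fin 3)), HasTypeITimeDecay C v ∧ HasTypeIDecay (M / ν) v ∧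
      ContinuousOn (Function.uncurry v) (Set.Iio (0 : ℝ) ×ˢ Set.univ) ∧
      (∀ s t : ℝ, s < t → t < 0 → ∀ x, v t x = UnboundedOperators.heatExtension (v s) (t - s) x - oseenDuhamel 1 s v v t x) ∧
      (∀ t < 0, VectorCalculus.IsDivFree (v t)) ∧ IsBackwardSingularPoint v 0 ∧
      ∀ (κ μ : ℝ), 0 < κ → 0 < μ → ∀ (U : Set (EuclideanSpace ℝ (Fin 3))), IsOpen U → U.Nonempty →
        DefectFades T x₀ u κ μ U → HasTwoPointSymmetry κ μ v := by
  obtain ⟨C, v, lam, hlam, hlam0, ⟨hrate, hcont, hmild, hdiv⟩, hsing, hconv⟩ :=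
    Summit.NavierStokesRegularity.NavierStokesRegularity.Theorems.LocalVelCompTubeDoorLocalPointZoomVelSlices.localPointZoomVelSlices
      ν T hν hT u p hcl hLH hdec x₀ ρ M hρ
      (Summit.NavierStokesRegularity.NavierStokesRegularity.Theorems.PlaneStrainDoorZoomSpaceTimeDecay.timeTypeI_of_spaceTimeTypeI hM)
      hnot
  have hdecay : HasTypeIDecay (M / ν) v :=
    Summit.NavierStokesRegularity.NavierStokesRegularity.Theorems.PlaneStrainDoorZoomSpaceTimeDecay.hasTypeIDecay_of_zoom
      hν hT hρ hlam hlam0 hM hconv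
  refine ⟨C, v, hrate, hdecay, hcont, hmild, hdiv, hsing, fun κ μ hκ hμ U hU hUne hfade => ?_⟩
  have hslice : ∀ s < 0, Continuous (v s) := fun s hs => by
    rw [← continuousOn_univ]
    exact (analyticOnNhd_slice hcont (bdd_of_hasTypeITimeDecay hrate) hmild hs).continuousOn
  exact hasTwoPointSymmetry_of_window hrate hcont hmild hν hκ hμ hU hUne fun s hs y hy =>
    twoTime_windowLimit hν hT hcl hlam hlam0 hslice hconv hκ hμ hU hfade hs hy

/-! ## §4 Residues -/

section Residues

variable {C : ℝ} {v : ℝ → EuclideanSpace ℝ (Fin 3) → EuclideanSpace ℝ (Fin 3)}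

/-- Inversion: a `(κ, μ)` symmetry is a `(κ⁻¹, μ⁻¹)` symmetry. -/
theorem _root_.Summit.NavierStokesRegularity.NavierStokesRegularity.Theorems.PeepholeEchoDoorDefs.HasTwoPointSymmetry.inv {κ μ : ℝ} (hκ : 0 < κ) (hμ : 0 < μ) (h : HasTwoPointSymmetry κ μ v) :
    HasTwoPointSymmetry κ⁻¹ μ⁻¹ v := by
  intro s hs z
  have hκs : κ⁻¹ * s < 0 := mul_neg_of_pos_of_neg (inv_pos.2 hκ) hs
  have h1 := h (κ⁻¹ * s) hκs (μ⁻¹ • z)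
  rw [← mul_assoc, mul_inv_cancel₀ hκ.ne', one_mul, smul_smul, mul_inv_cancel₀ hμ.ne', one_smul] at h1
  rw [h1, smul_smul, inv_mul_cancel₀ hμ.ne', one_smul]

/-- Composition: a `(κ₁, μ₁)` and a `(κ₂, μ₂)` symmetry give a `(κ₁κ₂, μ₁μ₂)` symmetry. -/
theorem _root_.Summit.NavierStokesRegularity.NavierStokesRegularity.Theorems.PeepholeEchoDoorDefs.HasTwoPointSymmetry.mul {κ₁ μ₁ κ₂ μ₂ : ℝ} (hκ₁ : 0 < κ₁) (_hκ₂ : 0 < κ₂)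
    (h₁ : HasTwoPointSymmetry κ₁ μ₁ v) (h₂ : HasTwoPointSymmetry κ₂ μ₂ v) :
    HasTwoPointSymmetry (κ₁ * κ₂) (μ₁ * μ₂) v := by
  intro s hs z
  have hκ₁s : κ₁ * s < 0 := mul_neg_of_pos_of_neg hκ₁ hs
  rw [h₁ s hs z, h₂ (κ₁ * s) hκ₁s (μ₁ • z), smul_smul, smul_smul,
    show κ₂ * (κ₁ * s) = κ₁ * κ₂ * s by ring, mul_comm μ₂ μ₁]

/-- Iteration: a `(κ, μ)` symmetry gives a `(κⁿ, μⁿ)` symmetry. -/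
theorem _root_.Summit.NavierStokesRegularity.NavierStokesRegularity.Theorems.PeepholeEchoDoorDefs.HasTwoPointSymmetry.pow {κ μ : ℝ} (hκ : 0 < κ) (h : HasTwoPointSymmetry κ μ v) (n : ℕ) :
    HasTwoPointSymmetry (κ ^ n) (μ ^ n) v := by
  induction n with
  | zero =>
    intro s hs z
    simp
  | succ n ih =>
    have := ih.mul (pow_pos hκ n) hκ h
    simpa [pow_succ] using this

/-- **OFF-DIAGONAL RESIDUE, contracting case** `μ² < κ`: the rate kills the profile. -/
theorem eq_zero_of_twoPoint_lt {κ μ : ℝ} (hκ : 0 < κ) (hμ : 0 < μ) (hlt : μ ^ 2 < κ)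
    (hrate : HasTypeITimeDecay C v) (h : HasTwoPointSymmetry κ μ v) : ∀ t < 0, ∀ x, v t x = 0 := by
  intro t ht x
  have hnt : 0 < -t := neg_pos.2 ht
  -- the ratio `r = μ/√κ ∈ (0,1)`
  set r : ℝ := μ / Real.sqrt κ with hr
  have hsκ : 0 < Real.sqrt κ := Real.sqrt_pos.2 hκ
  have hr0 : 0 ≤ r := div_nonneg hμ.le hsκ.le
  have hr1 : r < 1 := by
    rw [hr, div_lt_one hsκ]
    have : μ = Real.sqrt (μ ^ 2) := (Real.sqrt_sq hμ.le).symm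
    rw [this]
    exact Real.sqrt_lt_sqrt (sq_nonneg μ) hlt
  -- `‖v t x‖ ≤ (C/√(−t)) · rⁿ` for every `n`
  have hbound : ∀ n : ℕ, ‖v t x‖ ≤ C / Real.sqrt (-t) * r ^ n := by
    intro n
    have hn := h.pow hκ n t ht x
    have hκnt : κ ^ n * t < 0 := mul_neg_of_pos_of_neg (pow_pos hκ n) ht
    have hdec := hrate (κ ^ n * t) hκnt (μ ^ n • x)
    rw [hn, norm_smul, Real.norm_of_nonneg (pow_nonneg hμ.le n)]
    have hsq : Real.sqrt (-(κ ^ n * t)) = Real.sqrt κ ^ n * Real.sqrt (-t) := by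
      rw [show -(κ ^ n * t) = κ ^ n * (-t) by ring, Real.sqrt_mul (pow_nonneg hκ.le n)]
      congr 1
      rw [show κ ^ n = (Real.sqrt κ ^ n) ^ 2 by rw [← pow_mul, mul_comm, pow_mul, Real.sq_sqrt hκ.le],
        Real.sqrt_sq (pow_nonneg hsκ.le n)]
    rw [hsq] at hdec
    have hsκn : 0 < Real.sqrt κ ^ n := pow_pos hsκ n
    calc μ ^ n * ‖v (κ ^ n * t) (μ ^ n • x)‖ ≤ μ ^ n * (C / (Real.sqrt κ ^ n * Real.sqrt (-t))) :=
          mul_le_mul_of_nonneg_left hdec (pow_nonneg hμ.le n)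
      _ = C / Real.sqrt (-t) * r ^ n := by
          rw [hr, div_pow]
          field_simp
  -- the right-hand side tends to `0`
  have hlim : Tendsto (fun n : ℕ => C / Real.sqrt (-t) * r ^ n) atTop (𝓝 (C / Real.sqrt (-t) * 0)) :=
    (tendsto_pow_atTop_nhds_zero_of_lt_one hr0 hr1).const_mul _
  rw [mul_zero] at hlim
  have hle : ‖v t x‖ ≤ 0 := ge_of_tendsto' hlim fun n => hbound n
  exact norm_eq_zero.1 (le_antisymm hle (norm_nonneg _))

/-- **OFF-DIAGONAL RESIDUE** (both cases, by inversion). -/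
theorem offDiagonalResidue_holds : OffDiagonalResidue := by
  intro κ μ hκ hμ hne C v hrate h
  rcases lt_or_gt_of_ne hne with hlt | hgt
  · exact eq_zero_of_twoPoint_lt hκ hμ hlt hrate h
  · have hinv := h.inv hκ hμ
    refine eq_zero_of_twoPoint_lt (inv_pos.2 hκ) (inv_pos.2 hμ) ?_ hrate hinv
    rw [inv_pow]
    exact (inv_lt_inv₀ (by positivity) hκ).2 hgt

/-- **DIAGONAL, ALL RATIOS** (Tsai 1998 in the class, tree `nonflatLiouville_of_scaleInvariant`). -/
theorem allRatiosResidue_holds : AllRatiosResidue := by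
  intro C v hrate hcont hmild hdiv hall
  refine nonflatLiouville_of_scaleInvariant hrate hcont hmild hdiv fun lam hlam s hs y => ?_
  have h := hall (lam ^ 2) (by positivity) s hs y
  rw [Real.sqrt_sq hlam.le] at h
  exact h.symm

/-- From echoes at every ratio in `(0,1)` to echoes at every ratio. -/
theorem hasTwoPointSymmetry_all_of_lt_one
    (h : ∀ κ : ℝ, 0 < κ → κ < 1 → HasTwoPointSymmetry κ (Real.sqrt κ) v) :
    ∀ κ : ℝ, 0 < κ → HasTwoPointSymmetry κ (Real.sqrt κ) v := by
  intro κ hκ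
  rcases lt_trichotomy κ 1 with hlt | heq | hgt
  · exact h κ hκ hlt
  · subst heq
    intro s hs z
    simp
  · have h1 : κ⁻¹ < 1 := inv_lt_one_of_one_lt₀ hgt
    have hinv := (h κ⁻¹ (inv_pos.2 hκ) h1).inv (inv_pos.2 hκ) (Real.sqrt_pos.2 (inv_pos.2 hκ))
    rw [inv_inv, Real.sqrt_inv, inv_inv] at hinv
    exact hinv

/-- **KRONECKER**: echoes at two ratios `κ₁, κ₂ ∈ (0,1)` with `log κ₁ / log κ₂` irrational, for a profile continuous
on the open slab, give echoes at EVERY ratio (the echo ratios form a closed multiplicative subgroup of `(0,∞)`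
containing two incommensurable elements). -/
theorem hasTwoPointSymmetry_all_of_two (hcont : ContinuousOn (uncurry v) (Iio (0 : ℝ) ×ˢ univ))
    {κ₁ κ₂ : ℝ} (hκ₁ : 0 < κ₁) (_hκ₁1 : κ₁ < 1) (hκ₂ : 0 < κ₂) (hκ₂1 : κ₂ < 1)
    (hirr : Irrational (Real.log κ₁ / Real.log κ₂))
    (h₁ : HasTwoPointSymmetry κ₁ (Real.sqrt κ₁) v) (h₂ : HasTwoPointSymmetry κ₂ (Real.sqrt κ₂) v) :
    ∀ κ : ℝ, 0 < κ → HasTwoPointSymmetry κ (Real.sqrt κ) v := by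
  -- the additive subgroup of log-ratios
  let S : AddSubgroup ℝ :=
    { carrier := {a : ℝ | HasTwoPointSymmetry (Real.exp a) (Real.sqrt (Real.exp a)) v}
      zero_mem' := by
        intro s hs z
        simp
      add_mem' := by
        intro a b ha hb
        have h := HasTwoPointSymmetry.mul (Real.exp_pos a) (Real.exp_pos b) ha hb
        show HasTwoPointSymmetry (Real.exp (a + b)) (Real.sqrt (Real.exp (a + b))) v
        rw [Real.exp_add, Real.sqrt_mul (Real.exp_pos a).le]
        exact h
      neg_mem' := by
        intro a ha
        have h := HasTwoPointSymmetry.inv (Real.exp_pos a) (Real.sqrt_pos.2 (Real.exp_pos a)) ha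
        show HasTwoPointSymmetry (Real.exp (-a)) (Real.sqrt (Real.exp (-a))) v
        rw [Real.exp_neg, Real.sqrt_inv]
        exact h }
  -- it is closed (continuity of `v` on the open slab)
  have hclosed : IsClosed (S : Set ℝ) := by
    have hS : (S : Set ℝ) = ⋂ (s : ℝ) (hs : s < 0) (z : EuclideanSpace ℝ (Fin 3)),
        {a : ℝ | v s z = Real.sqrt (Real.exp a) • v (Real.exp a * s) (Real.sqrt (Real.exp a) • z)} := by
      ext a
      simp only [mem_iInter, mem_setOf_eq]
      rfl
    rw [hS]
    refine isClosed_iInter fun s => isClosed_iInter fun hs => isClosed_iInter fun z => ?_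
    have hφ : Continuous fun a : ℝ => (Real.exp a * s, Real.sqrt (Real.exp a) • z) :=
      (Real.continuous_exp.mul continuous_const).prodMk ((Real.continuous_sqrt.comp Real.continuous_exp).smul
        continuous_const)
    have hφmem : ∀ a : ℝ, (Real.exp a * s, Real.sqrt (Real.exp a) • z) ∈ Iio (0 : ℝ) ×ˢ (univ : Set (EuclideanSpace ℝ (Fin 3))) :=
      fun a => mem_prod.2 ⟨mul_neg_of_pos_of_neg (Real.exp_pos a) hs, mem_univ _⟩
    have hF : Continuous fun a : ℝ => Real.sqrt (Real.exp a) • v (Real.exp a * s) (Real.sqrt (Real.exp a) • z) := by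
      have hc : Continuous fun a : ℝ => uncurry v (Real.exp a * s, Real.sqrt (Real.exp a) • z) :=
        hcont.comp_continuous hφ hφmem
      exact (Real.continuous_sqrt.comp Real.continuous_exp).smul hc
    exact isClosed_eq continuous_const hF
  -- it contains the two incommensurable log-ratios, hence is not cyclic, hence dense
  have hmem₁ : Real.log κ₁ ∈ S := by
    show HasTwoPointSymmetry (Real.exp (Real.log κ₁)) (Real.sqrt (Real.exp (Real.log κ₁))) v
    rw [Real.exp_log hκ₁]; exact h₁
  have hmem₂ : Real.log κ₂ ∈ S := by
    show HasTwoPointSymmetry (Real.exp (Real.log κ₂)) (Real.sqrt (Real.exp (Real.log κ₂))) v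
    rw [Real.exp_log hκ₂]; exact h₂
  have hlog₂ : Real.log κ₂ ≠ 0 := (Real.log_neg hκ₂ hκ₂1).ne
  have hdense : Dense (S : Set ℝ) := by
    rcases AddSubgroup.dense_or_cyclic S with hd | ⟨a, ha⟩
    · exact hd
    · exfalso
      rw [ha] at hmem₁ hmem₂
      obtain ⟨m, hm⟩ := AddSubgroup.mem_closure_singleton.1 hmem₁
      obtain ⟨n, hn⟩ := AddSubgroup.mem_closure_singleton.1 hmem₂
      have hn0 : (n : ℝ) ≠ 0 := by
        intro h0
        apply hlog₂
        rw [← hn, zsmul_eq_mul, h0, zero_mul]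
      have ha0 : a ≠ 0 := by
        intro h0
        apply hlog₂
        rw [← hn, h0, smul_zero]
      apply hirr
      refine ⟨(m : ℚ) / n, ?_⟩
      rw [← hm, ← hn, zsmul_eq_mul, zsmul_eq_mul]
      push_cast
      field_simp
  -- closed and dense: everything
  have huniv : (S : Set ℝ) = univ := by
    rw [← hdense.closure_eq, hclosed.closure_eq]
  intro κ hκ
  have hk : Real.log κ ∈ (S : Set ℝ) := by rw [huniv]; exact mem_univ _
  have hk' : HasTwoPointSymmetry (Real.exp (Real.log κ)) (Real.sqrt (Real.exp (Real.log κ))) v := hk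
  rw [Real.exp_log hκ] at hk'
  exact hk'


end Residues


end Summit.NavierStokesRegularity.NavierStokesRegularity.Theorems.PeepholeEchoDoorResidues

end
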